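import Literature.NumberTheory.LFunctions.DirichletPolynomialMeanValue
import Literature.NumberTheory.LFunctions.HilbertInequalityEigen

/-!
# Mean values of Dirichlet polynomials: proof of the Montgomery–Vaughan Hilbert inequality

Discharge of the named fact
`Literature.NumberTheory.LFunctions.montgomeryVaughan_hilbertInequality` (Ivić 1985, (5.34);
Montgomery–Vaughan 1974): for `R ≥ 2`, distinct reals `λ_1, …, λ_R`, `δ_n = min_{m≠n} |λ_n - λ_m|`
and complex `a_n`,

`|∑_{m≠n} a_m ā_n (λ_m - λ_n)^{-1}| ≤ (3π/2) ∑_n |a_n|² δ_n^{-1}`.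

## Proof

Shan's elementary proof as printed in Pan Chengdong–Pan Chengbiao, *Foundations of analytic
number theory*, Ch. 28 §§3–4 (Theorem 4 there gives the constant `4.452 < 3π/2`; with the crude
spacing constants of `HilbertInequalitySpacing` one still gets `√(107/5) < 4.63 < 3π/2`):

* put `a_n = δ_n^{1/2} y_n`; the form becomes `∑ K_{mn} y_m ȳ_n` with the real antisymmetric kernel
  `K_{mn} = δ_m^{1/2}δ_n^{1/2}/(λ_m - λ_n)`, and `A = iK` is a Hermitian matrix;
* (Pan–Pan §3 Lemma 3, linear algebra) a Hermitian form is bounded by the largest modulus of an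
  eigenvalue: `|u* A u| ≤ (max_i |λ_i|) ‖u‖²` (`norm_form_le_of_eigenvalues`, via Mathlib's
  `Matrix.IsHermitian.eigenvectorBasis`);
* every eigenvalue satisfies `|λ_i| ≤ 3π/2` (`MontgomeryVaughan.abs_mu_le`, the eigenvector
  computation of `HilbertInequalityEigen`).

## Sources

* A. Ivić, *The Riemann zeta-function* (1985), (5.34), p. 139 (statement, no proof).
* H. L. Montgomery, R. C. Vaughan, *Hilbert's inequality*, J. London Math. Soc. (2) 8 (1974) 73–82.
* Pan Chengdong, Pan Chengbiao, *解析数论基础*, Science Press 1991, Ch. 28 §3 Lemma 3, §4 Theorem 4.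
-/

open Finset Real Complex Matrix
open scoped ComplexConjugate InnerProductSpace

namespace Literature.NumberTheory.LFunctions

namespace MontgomeryVaughan

/-- **Hermitian forms are bounded by the spectral radius** (Pan–Pan, Ch. 28 §3, Lemma 3, in the
form needed): if every eigenvalue of the Hermitian matrix `A` has modulus `≤ C`, then
`|u* A u| ≤ C ∑ |u_i|²`.  Proof: expand `u` in Mathlib's orthonormal eigenvector basis,
`⟪u, Au⟫ = ∑ λ_i |⟪b_i, u⟫|²`. [cite: PanPan1991, Ch. 28 §3 Lemma 3] -/
theorem norm_form_le_of_eigenvalues {n : Type*} [Fintype n] [DecidableEq n]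
    {A : Matrix n n ℂ} (hA : A.IsHermitian) {C : ℝ}
    (hC : ∀ i, |hA.eigenvalues i| ≤ C) (u : n → ℂ) :
    ‖star u ⬝ᵥ (A *ᵥ u)‖ ≤ C * ∑ i, ‖u i‖ ^ 2 := by
  set U : EuclideanSpace ℂ n := WithLp.toLp 2 u with hU
  set T := Matrix.toEuclideanLin A with hT_def
  have hT : T.IsSymmetric := Matrix.isSymmetric_toEuclideanLin_iff.mpr hA
  set b := hA.eigenvectorBasis with hb
  have hTb : ∀ i, T (b i) = (hA.eigenvalues i : ℂ) • b i := by
    intro i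
    simp only [hT_def, Matrix.toLpLin_apply]
    have h := hA.mulVec_eigenvectorBasis i
    rw [← hb] at h
    rw [show (b i).ofLp = ⇑(b i) from rfl, h, RCLike.real_smul_eq_coe_smul (K := ℂ)]
    rfl
  have hrepr : ∀ i, ⟪b i, T U⟫_ℂ = (hA.eigenvalues i : ℂ) * ⟪b i, U⟫_ℂ := by
    intro i
    rw [← hT (b i) U, hTb i, inner_smul_left, Complex.conj_ofReal]
  have hform : ⟪U, T U⟫_ℂ = ∑ i, (hA.eigenvalues i : ℂ) * ((‖⟪b i, U⟫_ℂ‖ ^ 2 : ℝ) : ℂ) := by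
    rw [← b.sum_inner_mul_inner U (T U)]
    refine Finset.sum_congr rfl fun i _ => ?_
    rw [hrepr i, ← inner_conj_symm U (b i)]
    have : conj ⟪b i, U⟫_ℂ * ⟪b i, U⟫_ℂ = ((‖⟪b i, U⟫_ℂ‖ ^ 2 : ℝ) : ℂ) := by
      rw [mul_comm, Complex.mul_conj, Complex.normSq_eq_norm_sq]
    rw [← this]
    ring
  have hnormU : ∑ i, ‖⟪b i, U⟫_ℂ‖ ^ 2 = ∑ i, ‖u i‖ ^ 2 := by
    have h1 : ‖U‖ ^ 2 = ∑ i, ‖⟪b i, U⟫_ℂ‖ ^ 2 := by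
      rw [← b.repr.norm_map U, EuclideanSpace.norm_sq_eq]
      simp only [OrthonormalBasis.repr_apply_apply]
    rw [← h1, EuclideanSpace.norm_sq_eq]
  have hinner : ⟪U, T U⟫_ℂ = star u ⬝ᵥ (A *ᵥ u) := by
    rw [EuclideanSpace.inner_eq_star_dotProduct]
    simp only [hT_def, Matrix.toLpLin_apply, hU]
    rw [dotProduct_comm]
  calc ‖star u ⬝ᵥ (A *ᵥ u)‖ = ‖⟪U, T U⟫_ℂ‖ := by rw [hinner]
    _ = ‖∑ i, (hA.eigenvalues i : ℂ) * ((‖⟪b i, U⟫_ℂ‖ ^ 2 : ℝ) : ℂ)‖ := by rw [hform]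
    _ ≤ ∑ i, |hA.eigenvalues i| * ‖⟪b i, U⟫_ℂ‖ ^ 2 := by
        refine (norm_sum_le _ _).trans (Finset.sum_le_sum fun i _ => le_of_eq ?_)
        rw [norm_mul, Complex.norm_real, Complex.norm_real, Real.norm_eq_abs,
          Real.norm_of_nonneg (by positivity)]
    _ ≤ ∑ i, C * ‖⟪b i, U⟫_ℂ‖ ^ 2 :=
        Finset.sum_le_sum fun i _ => mul_le_mul_of_nonneg_right (hC i) (by positivity)
    _ = C * ∑ i, ‖u i‖ ^ 2 := by rw [← Finset.mul_sum, hnormU]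

/-- Every eigenvalue of `A = iK`, `K` the weighted Hilbert kernel of a `δ`-separated configuration,
has modulus at most `3π/2` (apply `abs_mu_le` to Mathlib's unit eigenvectors).
[cite: PanPan1991, Ch. 28 §4 Theorem 4] -/
theorem abs_eigenvalue_le {ι : Type*} [Fintype ι] [DecidableEq ι] {x δ c : ι → ℝ}
    {K : ι → ι → ℝ} (hδ : ∀ r, 0 < δ r) (hsep : ∀ r s, r ≠ s → δ r ≤ |x r - x s|)
    (hc : ∀ r, c r = Real.sqrt (δ r)) (hK : ∀ r s, K r s = c r * c s / (x r - x s))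
    {A : Matrix ι ι ℂ} (hAK : ∀ r s, A r s = I * (K r s : ℂ)) (hA : A.IsHermitian) (i : ι) :
    |hA.eigenvalues i| ≤ 3 * π / 2 := by
  set v : ι → ℂ := ⇑(hA.eigenvectorBasis i) with hv_def
  have hv : ∑ r, ‖v r‖ ^ 2 = 1 := by
    have h1 := EuclideanSpace.norm_sq_eq (hA.eigenvectorBasis i)
    rw [hA.eigenvectorBasis.orthonormal.1 i, one_pow] at h1
    exact h1.symm
  have heig : ∀ r, ∑ s, (K r s : ℂ) * v s = I * ↑(-hA.eigenvalues i) * v r := by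
    intro r
    have h := congrFun (hA.mulVec_eigenvectorBasis i) r
    simp only [Matrix.mulVec, dotProduct, Pi.smul_apply, Complex.real_smul] at h
    have h2 : ∑ s, (K r s : ℂ) * v s = -I * ∑ s, A r s * v s := by
      rw [Finset.mul_sum]
      refine Finset.sum_congr rfl fun s _ => ?_
      rw [hAK]
      ring_nf
      rw [Complex.I_sq]
      ring
    rw [h2, h]
    push_cast
    ring
  have := abs_mu_le hδ hsep hc hK v (-hA.eigenvalues i) hv heig
  rwa [abs_neg] at this

end MontgomeryVaughan

open MontgomeryVaughan in
/-- **The generalised Hilbert inequality of Montgomery–Vaughan, Ivić (5.34)** — discharge of the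
named fact `montgomeryVaughan_hilbertInequality`: for `R ≥ 2`, distinct reals `λ_n` with
`δ_n = min_{m≠n} |λ_n - λ_m|`, and complex `a_n`,
`|∑_{m≠n} a_m ā_n/(λ_m - λ_n)| ≤ (3π/2) ∑_n |a_n|²/δ_n`.  Proof: Shan's eigenvalue argument as
printed in Pan–Pan, Ch. 28 §4 (Theorem 4, constant `4.452`; here with crude spacing constants,
`√(107/5) ≤ 3π/2`). [cite: Ivic1985, (5.34)] -/
theorem montgomeryVaughan_hilbertInequality_holds : montgomeryVaughan_hilbertInequality := by
  intro R lam a hR hinj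
  -- the spacing function `δ` and its two properties
  have hne : ∀ n : Fin R, Nonempty {m : Fin R // m ≠ n} := by
    intro n
    by_cases h : (n : ℕ) = 0
    · exact ⟨⟨⟨1, by omega⟩, fun e => by simp [Fin.ext_iff, h] at e⟩⟩
    · exact ⟨⟨⟨0, by omega⟩, fun e => h (by rw [← e])⟩⟩
  set δ : Fin R → ℝ := fun n => ⨅ m : {m : Fin R // m ≠ n}, |lam n - lam m| with hδ_def
  have hδpos : ∀ n, 0 < δ n := by
    intro n
    haveI := hne n
    obtain ⟨m, hm⟩ :=
      exists_eq_ciInf_of_finite (f := fun m : {m : Fin R // m ≠ n} => |lam n - lam m|)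
    show 0 < ⨅ m : {m : Fin R // m ≠ n}, |lam n - lam m|
    rw [← hm]
    exact abs_pos.mpr (sub_ne_zero.mpr fun h => m.2 (hinj h).symm)
  have hsep : ∀ r s, r ≠ s → δ r ≤ |lam r - lam s| := by
    intro r s hrs
    exact ciInf_le (Set.finite_range fun m : {m : Fin R // m ≠ r} => |lam r - lam m|).bddBelow
      (⟨s, Ne.symm hrs⟩ : {m : Fin R // m ≠ r})
  -- kernel, Hermitian matrix, eigenvalue bound
  set c : Fin R → ℝ := fun r => Real.sqrt (δ r) with hc_def
  have hc0 : ∀ r, 0 < c r := fun r => Real.sqrt_pos.mpr (hδpos r)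
  set K : Fin R → Fin R → ℝ := fun r s => c r * c s / (lam r - lam s) with hK_def
  have hanti : ∀ r s, K s r = -K r s := by
    intro r s
    simp only [hK_def]
    rw [show lam s - lam r = -(lam r - lam s) by ring, div_neg]
    ring
  set A : Matrix (Fin R) (Fin R) ℂ := Matrix.of fun r s => I * (K r s : ℂ) with hA_def
  have hAK : ∀ r s, A r s = I * (K r s : ℂ) := fun r s => rfl
  have hA : A.IsHermitian := by
    refine Matrix.IsHermitian.ext fun r s => ?_
    rw [hAK, hAK, hanti r s]
    push_cast
    simp only [star_mul', star_neg, Complex.star_def, Complex.conj_ofReal, Complex.conj_I]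
    ring
  have heigs : ∀ i, |hA.eigenvalues i| ≤ 3 * π / 2 := fun i =>
    abs_eigenvalue_le hδpos hsep (fun r => rfl) (fun r s => rfl) hAK hA i
  -- the vectors
  set y : Fin R → ℂ := fun n => a n / (c n : ℂ) with hy_def
  set u : Fin R → ℂ := fun n => conj (y n) with hu_def
  have hform := norm_form_le_of_eigenvalues hA heigs u
  -- identify the Hermitian form with `i ·` the bilinear form of the statement
  have hterm : ∀ m n, star (u m) * (A m n * u n) =
      I * (a m * conj (a n) / ((lam m - lam n : ℝ) : ℂ)) := by
    intro m n
    simp only [hu_def, hy_def, hAK, hK_def, Complex.star_def, map_div₀, Complex.conj_conj,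
      Complex.conj_ofReal]
    have hcm : (c m : ℂ) ≠ 0 := by exact_mod_cast (hc0 m).ne'
    have hcn : (c n : ℂ) ≠ 0 := by exact_mod_cast (hc0 n).ne'
    by_cases hL : lam m - lam n = 0
    · rw [hL]; simp
    · have hL' : ((lam m - lam n : ℝ) : ℂ) ≠ 0 := by exact_mod_cast hL
      push_cast
      field_simp
  have hS : star u ⬝ᵥ (A *ᵥ u) =
      I * ∑ m, ∑ n ∈ univ.erase m, a m * conj (a n) / ((lam m - lam n : ℝ) : ℂ) := by
    calc star u ⬝ᵥ (A *ᵥ u) = ∑ m, ∑ n, star (u m) * (A m n * u n) := by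
          simp only [dotProduct, Matrix.mulVec, Pi.star_apply, Finset.mul_sum]
      _ = ∑ m, ∑ n, I * (a m * conj (a n) / ((lam m - lam n : ℝ) : ℂ)) :=
          Finset.sum_congr rfl fun m _ => Finset.sum_congr rfl fun n _ => hterm m n
      _ = I * ∑ m, ∑ n, a m * conj (a n) / ((lam m - lam n : ℝ) : ℂ) := by
          rw [Finset.mul_sum]
          exact Finset.sum_congr rfl fun m _ => by rw [Finset.mul_sum]
      _ = I * ∑ m, ∑ n ∈ univ.erase m, a m * conj (a n) / ((lam m - lam n : ℝ) : ℂ) := by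
          congr 1
          refine Finset.sum_congr rfl fun m _ => ?_
          exact (Finset.sum_erase (f := fun n => a m * conj (a n) / ((lam m - lam n : ℝ) : ℂ))
            univ (by simp)).symm
  have hU : ∑ n, ‖u n‖ ^ 2 = ∑ n, ‖a n‖ ^ 2 / δ n := by
    refine Finset.sum_congr rfl fun n _ => ?_
    simp only [hu_def, hy_def, Complex.norm_conj, norm_div, Complex.norm_real,
      Real.norm_of_nonneg (hc0 n).le, div_pow]
    rw [hc_def]
    simp only [Real.sq_sqrt (hδpos n).le]
  -- conclude
  have hI : ‖star u ⬝ᵥ (A *ᵥ u)‖ =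
      ‖∑ m, ∑ n ∈ univ.erase m, a m * conj (a n) / ((lam m - lam n : ℝ) : ℂ)‖ := by
    rw [hS, norm_mul, Complex.norm_I, one_mul]
  calc ‖∑ m, ∑ n ∈ univ.erase m, a m * conj (a n) / ((lam m - lam n : ℝ) : ℂ)‖
      = ‖star u ⬝ᵥ (A *ᵥ u)‖ := hI.symm
    _ ≤ 3 * π / 2 * ∑ n, ‖u n‖ ^ 2 := hform
    _ = 3 / 2 * π * ∑ n, ‖a n‖ ^ 2 / δ n := by rw [hU]; ring

end Literature.NumberTheory.LFunctions
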